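import Literature.NumberTheory.NumberFields.UnitsEvenChiComponentRankOne
import HarnessLib

/-!
# The count of even eigen-units modulo `p`-th powers: at most `p` units `u_i` of a CM field `K` with
# `σ(u_i) ≡ u_i^{θ(σ)}` mod `K^{×p}` (`θ ≠ 1` even) that are pairwise distinct mod `K^{×p}`

Topic `NumberTheory/NumberFields`; namespace `Literature.NumberTheory.NumberFields.UnitGalois`. THEOREMS ONLY (no
definition, no named fact, no `sorry`). Sequel of `UnitsEvenChiComponentRankOne.lean` (Herbrand's unit theorem, even
part: `e_θ(ℤ_p ⊗ E_K/μ_K)` has `ℤ_p`-rank one for `K` CM Galois over `ℚ`, `p ∤ [K:ℚ]`, `θ` even `≠ 1`), turned into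
the COUNT that Kummer-theoretic reflection arguments consume: in the argument «radical `↦` ideal class» for an EVEN
radical character the kernel consists of UNITS in the `θ̄`-eigenspace of `E_K/E_K^p`, and that eigenspace has at most
`p` elements ([Washington1997] §10.2, proof of Thm. 10.9: the unit contribution `≤ 1` to `δ` for even components).

* §1 `natCard_le_of_mem_of_finrank_eq_one` — a family in a rank-one free `ℤ_p`-submodule `C ≤ N`, pairwise incongruent
  modulo `pN`, has `≤ p` members; `exists_eq_smul_of_one_tmul_eq_smul` — `1 ⊗ v ∈ p(ℤ_p ⊗ V) ⟹ v ∈ pV` for a finite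
  free `ℤ`-module `V`; `exists_charProjector_eq_add_smul` — `e_θ x ≡ x (mod p)` for a `θ̄`-eigenvector `x` mod `p`.
* §2 unit bookkeeping in a CM field: `exists_unit_eq_of_pow_eq_unit` (a `p`-th root in `K` of a unit is a unit),
  `coe_units_inv`, `exists_eq_pow_of_torsion_mul_pow` (an even eigen-unit that is a root of unity times a `p`-th power
  is a `p`-th power: `c ζ = ζ⁻¹`, `p` odd).
* §3 **`natCard_le_of_even_eigenunits`** — `K` CM Galois over `ℚ`, `p ∤ [K:ℚ]`, `θ : Gal(K/ℚ) →* ℤ_pˣ` even `≠ 1`,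
  `θ ≡ e (mod p)`; units `u_i` (`i ∈ ι`) with `σ(u_i) = u_i^{e σ} γ_{i,σ}^p` (`γ ∈ K`) and `u_i ∉ u_j K^{×p}` for `i ≠ j`
  ⟹ **`#ι ≤ p`**.

References: [Washington1997] §8.3 (`E/E^p` for `ℚ(ζ_p)`), §10.2 (reflection); [Tate1984Stark] Ch. I §3 Prop. 3.4,
§4.2 (Herbrand's unit theorem).
-/

noncomputable section

namespace Literature.NumberTheory.NumberFields

namespace UnitGalois

open Literature.RepresentationTheory.FiniteGroups
open _root_.NumberField _root_.NumberField.Units _root_.NumberField.InfinitePlace _root_.Module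
open scoped TensorProduct Classical

set_option maxSynthPendingDepth 3

/-! ## §1 Algebra: rank-one counting, `p`-divisibility under base change, `e_θ x ≡ x` -/

section CountAlgebra

variable {p : ℕ} [Fact p.Prime]

/-- **A family in a rank-one `ℤ_p`-submodule, pairwise incongruent modulo `p`, has at most `p` members**:
`C ≤ N` free of `ℤ_p`-rank `1`, `y_i ∈ C`, and `y_i − y_j ∈ p N ⟹ i = j`; then `#ι ≤ p` (coordinates in a basis
vector of `C`, reduced mod `p`, separate the `y_i`). [folklore] -/
private theorem natCard_le_of_mem_of_finrank_eq_one {N : Type*} [AddCommGroup N] [Module ℤ_[p] N]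
    (C : Submodule ℤ_[p] N) [Module.Free ℤ_[p] C] [Module.Finite ℤ_[p] C] (hC : finrank ℤ_[p] C = 1)
    {ι : Type*} [Finite ι] (y : ι → N) (hy : ∀ i, y i ∈ C)
    (hinj : ∀ i j, (∃ z : N, y i - y j = (p : ℤ_[p]) • z) → i = j) : Nat.card ι ≤ p := by
  let b := Module.Free.chooseBasis ℤ_[p] C
  have hcard : Fintype.card (Module.Free.ChooseBasisIndex ℤ_[p] C) = 1 := by
    rw [← Module.finrank_eq_card_chooseBasisIndex, hC]
  obtain ⟨i₀, hi₀⟩ := Fintype.card_eq_one_iff.1 hcard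
  have hrep : ∀ x : C, x = (b.repr x i₀) • b i₀ := fun x => by
    conv_lhs => rw [← b.sum_repr x]
    rw [Fintype.sum_eq_single i₀ (fun j hj => absurd (hi₀ j) hj)]
  let a : ι → ℤ_[p] := fun i => b.repr ⟨y i, hy i⟩ i₀
  have ha : ∀ i, y i = (((a i) • b i₀ : C) : N) := fun i => by
    have h := congrArg (fun x : C => (x : N)) (hrep ⟨y i, hy i⟩)
    exact h
  let f : ι → ZMod p := fun i => PadicInt.toZMod (a i)
  have hf : Function.Injective f := by
    intro i j hij
    apply hinj i j
    have hmem : a i - a j ∈ RingHom.ker (PadicInt.toZMod (p := p)) := by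
      rw [RingHom.mem_ker, map_sub, sub_eq_zero]
      exact hij
    rw [PadicInt.ker_toZMod, PadicInt.maximalIdeal_eq_span_p, Ideal.mem_span_singleton'] at hmem
    obtain ⟨c, hc⟩ := hmem
    refine ⟨((c • b i₀ : C) : N), ?_⟩
    rw [ha i, ha j, ← Submodule.coe_sub, ← sub_smul, ← hc, ← Submodule.coe_smul, smul_smul, mul_comm]
  haveI : NeZero p := ⟨(Fact.out : p.Prime).ne_zero⟩
  have h := Nat.card_le_card_of_injective f hf
  rwa [Nat.card_zmod] at h

/-- **`1 ⊗ v ∈ p·(ℤ_p ⊗ V) ⟹ v ∈ p·V`** for a finite free `ℤ`-module `V` (compare coordinates in a `ℤ`-basis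
and its base change; an integer of `p`-adic norm `< 1` is divisible by `p`). [folklore] -/
private theorem exists_eq_smul_of_one_tmul_eq_smul {V : Type*} [AddCommGroup V] [Module.Free ℤ V]
    [Module.Finite ℤ V] {v : V} {z : ℤ_[p] ⊗[ℤ] V} (h : (1 : ℤ_[p]) ⊗ₜ[ℤ] v = (p : ℤ_[p]) • z) :
    ∃ w : V, v = (p : ℤ) • w := by
  let b := Module.Free.chooseBasis ℤ V
  let bp := Algebra.TensorProduct.basis ℤ_[p] b
  have hcoord : ∀ i, ((b.repr v i : ℤ) : ℤ_[p]) = (p : ℤ_[p]) * bp.repr z i := by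
    intro i
    have h1 : bp.repr ((1 : ℤ_[p]) ⊗ₜ[ℤ] v) i = ((b.repr v i : ℤ) : ℤ_[p]) := by
      rw [Algebra.TensorProduct.basis_repr_tmul, one_smul, Finsupp.mapRange_apply]
      rfl
    rw [← h1, h, map_smul, Finsupp.smul_apply, smul_eq_mul]
  have hdvd : ∀ i, (p : ℤ) ∣ b.repr v i := fun i => by
    rw [← PadicInt.norm_int_lt_one_iff_dvd, hcoord i, norm_mul]
    calc ‖(p : ℤ_[p])‖ * ‖bp.repr z i‖ ≤ ‖(p : ℤ_[p])‖ * 1 :=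
          mul_le_mul_of_nonneg_left (PadicInt.norm_le_one _) (norm_nonneg _)
      _ < 1 := by
          rw [mul_one, PadicInt.norm_p]
          exact inv_lt_one_of_one_lt₀ (by exact_mod_cast (Fact.out : p.Prime).one_lt)
  choose m hm using hdvd
  refine ⟨∑ i, m i • b i, ?_⟩
  conv_lhs => rw [← b.sum_repr v]
  rw [Finset.smul_sum]
  refine Finset.sum_congr rfl fun i _ => ?_
  rw [hm i, smul_smul]

variable {G : Type*} [Group G] [Fintype G] {N : Type*} [AddCommGroup N] [Module ℤ_[p] N]

/-- An element of `ℤ_p` of norm `< 1` is `p` times an element of `ℤ_p`. [folklore] -/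
private theorem exists_eq_p_mul_of_norm_lt_one {x : ℤ_[p]} (hx : ‖x‖ < 1) : ∃ d : ℤ_[p], x = (p : ℤ_[p]) * d := by
  have hmem : x ∈ IsLocalRing.maximalIdeal ℤ_[p] := PadicInt.mem_nonunits.2 hx
  rw [PadicInt.maximalIdeal_eq_span_p, Ideal.mem_span_singleton'] at hmem
  obtain ⟨d, hd⟩ := hmem
  exact ⟨d, by rw [← hd, mul_comm]⟩

/-- **`e_θ x ≡ x (mod p)` for a `θ̄`-eigenvector `x` mod `p`.** If `|G| ∈ ℤ_pˣ`, `θ ≡ e (mod p)` and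
`ρ(σ) x = e(σ) x + p z_σ` for all `σ`, then `e_θ x = x + p z` for some `z`
(`e_θ x = |G|⁻¹ Σ_t θ(t) e(t⁻¹) x + p(…)` and `θ(t) e(t⁻¹) ≡ 1`). [folklore] -/
private theorem exists_charProjector_eq_add_smul (ρ : Representation ℤ_[p] G N) (hG : IsUnit (Fintype.card G : ℤ_[p]))
    (θ : G →* ℤ_[p]ˣ) (e : G → ℕ) (hθe : ∀ σ : G, ‖((θ σ : ℤ_[p]ˣ) : ℤ_[p]) - (e σ : ℤ_[p])‖ < 1)
    {x : N} (hx : ∀ σ : G, ∃ z : N, ρ σ x = (e σ : ℤ_[p]) • x + (p : ℤ_[p]) • z) :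
    ∃ z : N, charProjector ρ (fun g => ((θ g : ℤ_[p]ˣ) : ℤ_[p])) x = x + (p : ℤ_[p]) • z := by
  choose z hz using hx
  -- `θ(t) e(t⁻¹) = 1 + p d_t`
  have hd : ∀ t : G, ∃ d : ℤ_[p], ((θ t : ℤ_[p]ˣ) : ℤ_[p]) * (e t⁻¹ : ℤ_[p]) = 1 + (p : ℤ_[p]) * d := by
    intro t
    obtain ⟨d', hd'⟩ := exists_eq_p_mul_of_norm_lt_one (hθe t⁻¹)
    refine ⟨-(((θ t : ℤ_[p]ˣ) : ℤ_[p]) * d'), ?_⟩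
    have h1 : ((θ t : ℤ_[p]ˣ) : ℤ_[p]) * ((θ t⁻¹ : ℤ_[p]ˣ) : ℤ_[p]) = 1 := by
      rw [← Units.val_mul, ← map_mul, mul_inv_cancel, map_one, Units.val_one]
    have h2 : (e t⁻¹ : ℤ_[p]) = ((θ t⁻¹ : ℤ_[p]ˣ) : ℤ_[p]) - (p : ℤ_[p]) * d' := by rw [← hd']; ring
    rw [h2, mul_sub, h1]
    ring
  choose d hdd using hd
  refine ⟨Ring.inverse (Fintype.card G : ℤ_[p]) • ∑ t, (d t • x + ((θ t : ℤ_[p]ˣ) : ℤ_[p]) • z t⁻¹), ?_⟩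
  rw [charProjector_apply]
  have hterm : ∀ t : G, ((θ t : ℤ_[p]ˣ) : ℤ_[p]) • ρ t⁻¹ x =
      x + (p : ℤ_[p]) • (d t • x + ((θ t : ℤ_[p]ˣ) : ℤ_[p]) • z t⁻¹) := by
    intro t
    rw [hz t⁻¹, smul_add, smul_smul, smul_smul, hdd t, add_smul, one_smul, mul_smul,
      mul_comm ((θ t : ℤ_[p]ˣ) : ℤ_[p]) (p : ℤ_[p]), mul_smul, smul_add, add_assoc]
  simp_rw [hterm]
  rw [Finset.sum_add_distrib, Finset.sum_const, Finset.card_univ, ← Finset.smul_sum, smul_add,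
    ← Nat.cast_smul_eq_nsmul ℤ_[p], smul_smul, Ring.inverse_mul_cancel _ hG, one_smul, smul_comm]

end CountAlgebra

/-! ## §2 Units of a CM field: `p`-th roots of units, even eigen-units and roots of unity -/

section CountUnits

variable {K : Type*} [Field K] [NumberField K]

omit [NumberField K] in
/-- An element of `K` whose `p`-th power (`p ≠ 0`) is a unit of `𝓞 K` is itself a unit of `𝓞 K`
(it is integral, and a root of a unit is a unit). [folklore] -/
private theorem exists_unit_eq_of_pow_eq_unit {p : ℕ} (hp : p ≠ 0) {γ : K} {w : (𝓞 K)ˣ}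
    (h : γ ^ p = ((w : 𝓞 K) : K)) : ∃ v : (𝓞 K)ˣ, ((v : 𝓞 K) : K) = γ := by
  have hint : IsIntegral ℤ γ := by
    refine IsIntegral.of_pow (Nat.pos_of_ne_zero hp) ?_
    rw [h]
    exact (w : 𝓞 K).isIntegral_coe
  set γ' : 𝓞 K := ⟨γ, hint⟩ with hγ'
  have hpow : γ' ^ p = (w : 𝓞 K) := by
    apply RingOfIntegers.coe_injective
    change ((γ' ^ p : 𝓞 K) : K) = ((w : 𝓞 K) : K)
    push_cast
    exact h
  have hunit : IsUnit γ' := by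
    rw [← isUnit_pow_iff hp, hpow]
    exact Units.isUnit w
  exact ⟨hunit.unit, rfl⟩

omit [NumberField K] in
/-- In `K`: the inverse of a unit of `𝓞 K` is its field inverse. [folklore] -/
private theorem coe_units_inv (u : (𝓞 K)ˣ) : (((u⁻¹ : (𝓞 K)ˣ) : 𝓞 K) : K) = (((u : 𝓞 K) : K))⁻¹ := by
  apply eq_inv_of_mul_eq_one_left
  have h := congrArg (fun z : 𝓞 K => (z : K)) (Units.inv_mul u)
  push_cast at h
  exact h

variable [IsCMField K]

/-- In a CM field, **an even eigen-unit modulo `K^{×p}` that is a root of unity times a `p`-th power is a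
`p`-th power** (`p` odd): if `c(q) = q · δ^p` and `q = ζ r^p` with `ζ ∈ μ_K`, then (`c ζ = ζ⁻¹`)
`ζ² ∈ K^{×p}`, so `ζ ∈ K^{×p}`. [folklore] -/
private theorem exists_eq_pow_of_torsion_mul_pow {p : ℕ} (hp : p.Prime) (hp2 : p ≠ 2) {q : (𝓞 K)ˣ} {δ : K}
    (hq : IsCMField.complexConj K ((q : 𝓞 K) : K) = ((q : 𝓞 K) : K) * δ ^ p)
    {ζ : (𝓞 K)ˣ} (hζ : ζ ∈ torsion K) {r : (𝓞 K)ˣ} (hqr : q = ζ * r ^ p) :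
    ∃ s : (𝓞 K)ˣ, q = s ^ p := by
  -- `c ζ = ζ⁻¹`
  have hcζ : IsCMField.complexConj K ((ζ : 𝓞 K) : K) = ((ζ : 𝓞 K) : K)⁻¹ :=
    IsCMField.complexConj_torsion K ⟨ζ, hζ⟩
  have hζ0 : ((ζ : 𝓞 K) : K) ≠ 0 := by simp
  have hr0 : ((r : 𝓞 K) : K) ≠ 0 := by simp
  have hcr0 : IsCMField.complexConj K ((r : 𝓞 K) : K) ≠ 0 :=
    (map_ne_zero_iff _ (IsCMField.complexConj K).injective).2 hr0
  -- `η := r δ / c(r)` has `η^p = ζ⁻²`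
  set η : K := ((r : 𝓞 K) : K) * δ / IsCMField.complexConj K ((r : 𝓞 K) : K) with hη
  have hqK : ((q : 𝓞 K) : K) = ((ζ : 𝓞 K) : K) * ((r : 𝓞 K) : K) ^ p := by
    rw [hqr]; push_cast; ring
  have hηp : η ^ p = (((ζ : 𝓞 K) : K) ^ 2)⁻¹ := by
    have h1 := hq
    rw [hqK, map_mul, map_pow, hcζ] at h1
    -- h1 : ζ⁻¹ * c(r)^p = ζ * r^p * δ^p
    rw [hη, div_pow, mul_pow]
    field_simp
    field_simp at h1
    linear_combination -h1
  -- `η` is a unit of `𝓞 K` (its `p`-th power is the unit `ζ⁻²`)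
  obtain ⟨ηu, hηu⟩ := exists_unit_eq_of_pow_eq_unit hp.ne_zero (w := (ζ ^ 2)⁻¹) (γ := η)
    (by rw [hηp, coe_units_inv]; push_cast; rfl)
  have hηu2 : ηu ^ p = (ζ ^ 2)⁻¹ := by
    apply Units.ext
    apply RingOfIntegers.coe_injective
    change (((ηu ^ p : (𝓞 K)ˣ) : 𝓞 K) : K) = ((((ζ ^ 2)⁻¹ : (𝓞 K)ˣ) : 𝓞 K) : K)
    rw [coe_units_inv]
    push_cast [hηu]
    exact hηp
  -- `p = 2m + 1`; `ζ = ζ^p (ζ²)^{-m} = (ζ ηu^m)^p`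
  obtain ⟨m, hm⟩ := hp.odd_of_ne_two hp2
  refine ⟨ζ * ηu ^ m * r, ?_⟩
  rw [hqr, mul_pow, mul_pow, ← pow_mul, mul_comm m p, pow_mul, hηu2, inv_pow, ← pow_mul]
  have h2 : ζ ^ p * (ζ ^ (2 * m))⁻¹ = ζ := by
    rw [hm, pow_succ, mul_comm (ζ ^ (2 * m) * ζ) _, ← mul_assoc, inv_mul_cancel, one_mul]
  rw [h2]

variable [IsGalois ℚ K] {p : ℕ} [Fact p.Prime]

omit [IsCMField K] in
/-- `p ∤ [K:ℚ]` ⟹ `|Gal(K/ℚ)|` is a unit of `ℤ_p`. [folklore] -/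
private theorem isUnit_card_gal' (hpK : ¬ p ∣ finrank ℚ K) : IsUnit (Fintype.card Gal(K/ℚ) : ℤ_[p]) := by
  rw [← Nat.card_eq_fintype_card, IsGalois.card_aut_eq_finrank, PadicInt.isUnit_iff,
    PadicInt.norm_natCast_eq_one_iff]
  exact (Nat.Prime.coprime_iff_not_dvd Fact.out).2 hpK

omit [IsCMField K] [IsGalois ℚ K] [Fact p.Prime] in
/-- On classes of units: `ρ σ [y] = [σ y]` for such a `ρ`. [folklore] -/
private theorem unitsModTorsionRep_apply_mk {ρ : Representation ℤ Gal(K/ℚ) (Additive ((𝓞 K)ˣ ⧸ torsion K))}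
    (hρ : ∀ σ, ρ σ = unitsModTorsion σ) (σ : Gal(K/ℚ)) (y : (𝓞 K)ˣ) :
    ρ σ (Additive.ofMul (QuotientGroup.mk y : (𝓞 K)ˣ ⧸ torsion K)) =
      Additive.ofMul (QuotientGroup.mk (unitsGal σ y) : (𝓞 K)ˣ ⧸ torsion K) := by
  rw [hρ]; rfl

/-! ## §3 The count -/

omit [IsGalois ℚ K] in
/-- A CM field has even degree, so a prime not dividing `[K:ℚ]` is odd. [folklore] -/
private theorem ne_two_of_not_dvd_finrank (hpK : ¬ p ∣ finrank ℚ K) : p ≠ 2 := by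
  rintro rfl
  exact hpK ⟨_, IsTotallyComplex.finrank K⟩

/-- **THE COUNT OF EVEN EIGEN-UNITS MODULO `p`-TH POWERS.** Let `K` be a CM field, Galois over `ℚ`, `p ∤ [K:ℚ]`,
`θ : Gal(K/ℚ) →* ℤ_pˣ` EVEN (`θ(c) = 1`) and `≠ 1`, `e : Gal(K/ℚ) → ℕ` with `θ ≡ e (mod p)`. Let `(u_i)_{i ∈ ι}`
be units of `𝓞 K` such that (i) `σ(u_i) = u_i^{e σ} · γ^p` for every `σ` (some `γ ∈ K`): the class of `u_i` in
`K^×/K^{×p}` is a `θ̄`-eigenvector; (ii) `u_i ∉ u_j K^{×p}` for `i ≠ j`. Then **`#ι ≤ p`**: the classes `1 ⊗ [u_i]`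
reduce into `e_θ(ℤ_p ⊗ E_K/μ_K)/p ≅ ℤ/p` (rank one, §4) injectively (torsion: `c ζ = ζ⁻¹` and `θ(c) = 1` force the
root of unity to be a `p`-th power). This is the unit-obstruction bound `#(E_K/E_K^p)^{(θ̄)} ≤ p` of the Kummer
reflection argument for an EVEN radical character.
[cite: Washington1997, §10.2 (proof of Thm. 10.9: the unit contribution for even characters)] [cite: Tate1984Stark, Ch. I §3 Prop. 3.4] -/
theorem natCard_le_of_even_eigenunits (hpK : ¬ p ∣ finrank ℚ K) (θ : Gal(K/ℚ) →* ℤ_[p]ˣ) (hθ : θ ≠ 1)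
    (hc : θ ((IsCMField.complexConj K).restrictScalars ℚ) = 1) (e : Gal(K/ℚ) → ℕ)
    (hθe : ∀ σ : Gal(K/ℚ), ‖((θ σ : ℤ_[p]ˣ) : ℤ_[p]) - (e σ : ℤ_[p])‖ < 1)
    {ι : Type*} [Finite ι] (u : ι → (𝓞 K)ˣ)
    (heig : ∀ (i : ι) (σ : Gal(K/ℚ)), ∃ γ : K,
      σ (((u i : 𝓞 K) : K)) = ((u i : 𝓞 K) : K) ^ e σ * γ ^ p)
    (hinj : ∀ i j : ι, (∃ γ : K, ((u i : 𝓞 K) : K) = ((u j : 𝓞 K) : K) * γ ^ p) → i = j) :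
    Nat.card ι ≤ p := by
  have hp : p.Prime := Fact.out
  have hp2 : p ≠ 2 := ne_two_of_not_dvd_finrank (K := K) hpK
  have hG := isUnit_card_gal' (K := K) hpK
  set c := (IsCMField.complexConj K).restrictScalars ℚ with hcdef
  -- the modules
  obtain ⟨ρ, hρ⟩ := exists_unitsModTorsionRep K
  set ρp := baseChangeRep ℤ_[p] ρ with hρp
  set C := chiComponent ρp (fun g => ((θ g : ℤ_[p]ˣ) : ℤ_[p])) with hC
  have hC1 : finrank ℤ_[p] C = 1 := finrank_chiComponent_unitsModTorsion_eq_one hpK hρ θ hθ hc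
  -- the vectors
  let a : (𝓞 K)ˣ → Additive ((𝓞 K)ˣ ⧸ torsion K) := fun y => Additive.ofMul (QuotientGroup.mk y)
  have ha_mul : ∀ y y' : (𝓞 K)ˣ, a (y * y') = a y + a y' := fun y y' => by
    simp only [a, QuotientGroup.mk_mul, ofMul_mul]
  have ha_pow : ∀ (y : (𝓞 K)ˣ) (n : ℕ), a (y ^ n) = n • a y := fun y n => by
    simp only [a, QuotientGroup.mk_pow, ofMul_pow]
  let x : ι → ℤ_[p] ⊗[ℤ] Additive ((𝓞 K)ˣ ⧸ torsion K) := fun i => (1 : ℤ_[p]) ⊗ₜ a (u i)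
  -- Step 0: the `γ`'s are units
  have hv : ∀ (i : ι) (σ : Gal(K/ℚ)), ∃ v : (𝓞 K)ˣ, unitsGal σ (u i) = u i ^ e σ * v ^ p := by
    intro i σ
    obtain ⟨γ, hγ⟩ := heig i σ
    have hu0 : ((u i : 𝓞 K) : K) ≠ 0 := by simp
    have hcoe : (((unitsGal σ (u i) : (𝓞 K)ˣ) : 𝓞 K) : K) = ((u i : 𝓞 K) : K) ^ e σ * γ ^ p := by
      rw [coe_unitsGal]; exact hγ
    have hγp : γ ^ p = (((unitsGal σ (u i) * (u i ^ e σ)⁻¹ : (𝓞 K)ˣ) : 𝓞 K) : K) := by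
      push_cast [coe_units_inv, hcoe]
      field_simp
      rw [one_div, inv_pow, mul_assoc, mul_inv_cancel₀ (pow_ne_zero _ hu0), mul_one]
    obtain ⟨v, hvγ⟩ := exists_unit_eq_of_pow_eq_unit hp.ne_zero hγp
    refine ⟨v, Units.ext (RingOfIntegers.coe_injective ?_)⟩
    change (((unitsGal σ (u i) : (𝓞 K)ˣ) : 𝓞 K) : K) = (((u i ^ e σ * v ^ p : (𝓞 K)ˣ) : 𝓞 K) : K)
    rw [hcoe, ← hvγ]
    push_cast
    ring
  choose v hv using hv
  -- Step 2: `ρp σ (x i) = e σ • x i + p • (1 ⊗ a (v i σ))`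
  have hx : ∀ (i : ι) (σ : Gal(K/ℚ)), ∃ z, ρp σ (x i) = (e σ : ℤ_[p]) • x i + (p : ℤ_[p]) • z := by
    intro i σ
    refine ⟨(1 : ℤ_[p]) ⊗ₜ a (v i σ), ?_⟩
    change ρp σ ((1 : ℤ_[p]) ⊗ₜ a (u i)) = (e σ : ℤ_[p]) • ((1 : ℤ_[p]) ⊗ₜ a (u i)) + _
    rw [hρp, baseChangeRep_apply_tmul, show a (u i) = Additive.ofMul (QuotientGroup.mk (u i)) from rfl,
      unitsModTorsionRep_apply_mk hρ, hv i σ, show Additive.ofMul (QuotientGroup.mk (u i ^ e σ * v i σ ^ p) :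
        (𝓞 K)ˣ ⧸ torsion K) = a (u i ^ e σ * v i σ ^ p) from rfl, ha_mul, ha_pow, ha_pow,
      TensorProduct.tmul_add, TensorProduct.tmul_smul, TensorProduct.tmul_smul, Nat.cast_smul_eq_nsmul,
      Nat.cast_smul_eq_nsmul]
  -- Step 3: `y i := e_θ (x i) = x i + p • z i ∈ C`
  have hy : ∀ i : ι, ∃ z, charProjector ρp (fun g => ((θ g : ℤ_[p]ˣ) : ℤ_[p])) (x i) = x i + (p : ℤ_[p]) • z :=
    fun i => exists_charProjector_eq_add_smul ρp hG θ e hθe (hx i)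
  choose z hz using hy
  -- Step 4: `x i - x j ∈ p N ⟹ i = j`
  have hsep : ∀ i j : ι, (∃ t, x i - x j = (p : ℤ_[p]) • t) → i = j := by
    rintro i j ⟨t, ht⟩
    apply hinj i j
    have hsub : x i - x j = (1 : ℤ_[p]) ⊗ₜ a (u i * (u j)⁻¹) := by
      change (1 : ℤ_[p]) ⊗ₜ a (u i) - (1 : ℤ_[p]) ⊗ₜ a (u j) = _
      rw [← TensorProduct.tmul_sub]
      congr 1
    rw [hsub] at ht
    obtain ⟨w, hw⟩ := exists_eq_smul_of_one_tmul_eq_smul ht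
    obtain ⟨r, hr⟩ := QuotientGroup.mk_surjective (Additive.toMul w)
    have hw' : a (u i * (u j)⁻¹) = a (r ^ p) := by
      rw [hw, ha_pow, show a r = w by simp only [a, hr, ofMul_toMul], natCast_zsmul]
    have hquot : (QuotientGroup.mk (u i * (u j)⁻¹) : (𝓞 K)ˣ ⧸ torsion K) = QuotientGroup.mk (r ^ p) :=
      Additive.ofMul.injective hw'
    rw [QuotientGroup.eq] at hquot
    -- `(u i / u j)⁻¹ * r^p = ζ⁻¹ ∈ torsion`, i.e. `u i / u j = ζ r^p`... set `ζ := (u i / u j) * (r^p)⁻¹`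
    set q : (𝓞 K)ˣ := u i * (u j)⁻¹ with hqdef
    have hζmem : q * (r ^ p)⁻¹ ∈ torsion K := by
      have := Subgroup.inv_mem _ hquot
      rwa [mul_inv_rev, inv_inv, mul_comm] at this
    have hqr : q = (q * (r ^ p)⁻¹) * r ^ p := by rw [inv_mul_cancel_right]
    -- the eigen-relation of `q` at `c`: `c q = q^{e c} (γ_i/γ_j)^p = q · δ^p`
    obtain ⟨γi, hγi⟩ := heig i c
    obtain ⟨γj, hγj⟩ := heig j c
    have hec : ∃ m : ℕ, e c = p * m + 1 := by
      have h1 : ‖((θ c : ℤ_[p]ˣ) : ℤ_[p]) - (e c : ℤ_[p])‖ < 1 := hθe c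
      rw [hc, Units.val_one] at h1
      have h2 : (p : ℤ) ∣ ((e c : ℤ) - 1) := by
        rw [← PadicInt.norm_int_lt_one_iff_dvd]
        push_cast
        rw [norm_sub_rev]
        exact h1
      obtain ⟨k, hk⟩ := h2
      have hp2le : (2 : ℤ) ≤ p := by exact_mod_cast hp.two_le
      have hk0 : 0 ≤ k := by
        by_contra hneg
        have hk1 : k + 1 ≤ 0 := by omega
        have hprod : (p : ℤ) * (k + 1) ≤ 0 := mul_nonpos_of_nonneg_of_nonpos (by positivity) hk1
        have he0 : (0 : ℤ) ≤ (e c : ℤ) := by positivity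
        nlinarith
      refine ⟨k.toNat, ?_⟩
      zify
      rw [Int.toNat_of_nonneg hk0]
      linarith
    obtain ⟨m, hm⟩ := hec
    have huj0 : ((u j : 𝓞 K) : K) ≠ 0 := by simp
    have hγj0 : γj ≠ 0 := by
      intro h0
      rw [h0, zero_pow hp.ne_zero, mul_zero] at hγj
      exact (map_ne_zero_iff _ c.injective).2 huj0 hγj
    have hqK : ((q : 𝓞 K) : K) = ((u i : 𝓞 K) : K) / ((u j : 𝓞 K) : K) := by
      rw [hqdef, div_eq_mul_inv]
      push_cast [coe_units_inv]
      rfl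
    have hcq : IsCMField.complexConj K ((q : 𝓞 K) : K) =
        ((q : 𝓞 K) : K) * ((((q : 𝓞 K) : K)) ^ m * (γi / γj)) ^ p := by
      have hcq' : IsCMField.complexConj K ((q : 𝓞 K) : K) = c ((q : 𝓞 K) : K) := rfl
      rw [hcq', hqK, map_div₀, hγi, hγj, hm]
      ring
    obtain ⟨s, hs⟩ := exists_eq_pow_of_torsion_mul_pow hp hp2 hcq hζmem hqr
    refine ⟨((s : 𝓞 K) : K), ?_⟩
    have h1 : ((u i : 𝓞 K) : K) = ((q : 𝓞 K) : K) * ((u j : 𝓞 K) : K) := by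
      rw [hqK, div_mul_cancel₀ _ huj0]
    rw [h1, hs]
    push_cast
    ring
  -- conclude with the abstract count applied to `y i = e_θ (x i)`
  refine natCard_le_of_mem_of_finrank_eq_one C hC1
    (fun i => charProjector ρp (fun g => ((θ g : ℤ_[p]ˣ) : ℤ_[p])) (x i))
    (fun i => charProjector_mem_chiComponent ρp _ (x i)) fun i j hij => ?_
  obtain ⟨t, ht⟩ := hij
  refine hsep i j ⟨t - z i + z j, ?_⟩
  rw [hz i, hz j] at ht
  rw [smul_add, smul_sub, ← ht]
  abel

end CountUnits

end UnitGalois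

end Literature.NumberTheory.NumberFields

end
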